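import Mathlib
import Summits.Ventures.PercRepro.TriangleCapEightThirteenG
import Summits.Ventures.PercRepro.TriangleCapEightThirteenD
import Summits.Ventures.PercRepro.TriangleCapEightThirteenA
import Summits.Ventures.PercRepro.TriangleCapTwoBelowDiagonalNine

/-!
# PercRepro — THE CELL `(8, 13)`: TWO BELOW THE DIAGONAL IS EXACT ON THE `K₄⁻`-FREE CLASS FOR EVERY `k ≥ 8`
(p3, gen 37; part 80)

The dense-corner stability with gap `10` at `(8, 13)` by the number of triangles: none (triangle-free), one (an
outer vertex, or none: TriangleCapEightThirteenF), two (`k ≥ 8`), three (one shared vertex: part A; a path: part G;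
the windmill: the dense-corner theorem; three vertex-disjoint triangles do not fit on `8` vertices), four (part D),
five or more (`|T₃| ≥ 30` and the envelope, `six_mul_card_le_card_triangles3`).

* **`dense_stability_two_eight_thirteen`**, **`cell_eight_thirteen_k4m`** (`2·cherries ≤ 68`, attained) and
  **`two_below_diagonal_exact_k4m_of_eight`** — THE SUB-DIAGONAL `r = 2` OF THE CLOSED FORM IS EXACT ON THE
  `K₄⁻`-FREE CLASS ON EVERY CELL OF THE DENSE CORNER.
Axioms: standard.
-/

namespace PercRepro

namespace TriangleCap

namespace C047

open Finset

variable {V : Type*} [Fintype V] [DecidableEq V]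

/-- **THE THREE-TRIANGLE CASE AT `(8, 13)`.** -/
theorem three_triangles_stability_two_eight_thirteen (D : SimpleGraph V) [DecidableRel D.Adj] (hK : K4mFree D)
    (hk : Fintype.card V = 8) (hm : D.edgeFinset.card = 13) {u v w a b c x y z : V}
    (huv : D.Adj u v) (huw : D.Adj u w) (hvw : D.Adj v w) (hab : D.Adj a b) (hac : D.Adj a c) (hbc : D.Adj b c)
    (hxy : D.Adj x y) (hxz : D.Adj x z) (hyz : D.Adj y z)
    (ha : ¬ (a = u ∨ a = v ∨ a = w)) (hx : ¬ (x = u ∨ x = v ∨ x = w ∨ x = a ∨ x = b ∨ x = c)) :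
    ∑ v, deg D v * deg D v + 2 * (Fintype.card V - 3) ≤ D.edgeFinset.card * Fintype.card V := by
  have hm' : 2 * Fintype.card V ≤ D.edgeFinset.card + 3 := by omega
  set T₁ : Finset V := {u, v, w} with hT₁
  set T₂ : Finset V := {a, b, c} with hT₂
  set T₃ : Finset V := {x, y, z} with hT₃
  have h₁ : T₁.card = 3 := card_triple huv.ne huw.ne hvw.ne
  have h₂ : T₂.card = 3 := card_triple hab.ne hac.ne hbc.ne
  have h₃ : T₃.card = 3 := card_triple hxy.ne hxz.ne hyz.ne
  have hcl₁ := clique_triple D huv huw hvw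
  have hcl₂ := clique_triple D hab hac hbc
  have hcl₃ := clique_triple D hxy hxz hyz
  have hone₁ : ∀ z', z' ∉ T₁ → degIn D T₁ z' ≤ 1 := fun z' hz => degIn_le_one_of_triangle D hK huv huw hvw hz
  have hone₂ : ∀ z', z' ∉ T₂ → degIn D T₂ z' ≤ 1 := fun z' hz => degIn_le_one_of_triangle D hK hab hac hbc hz
  have hone₃ : ∀ z', z' ∉ T₃ → degIn D T₃ z' ≤ 1 := fun z' hz => degIn_le_one_of_triangle D hK hxy hxz hyz hz
  have hx1 : ¬ (x = u ∨ x = v ∨ x = w) := fun h => hx (by tauto)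
  have hx2 : ¬ (x = a ∨ x = b ∨ x = c) := fun h => hx (by tauto)
  have hi12 : (T₁ ∩ T₂).card ≤ 1 := inter_card_le_one_of_triangles D hK huv huw hvw hab hac hbc ha
  have hi13 : (T₁ ∩ T₃).card ≤ 1 := inter_card_le_one_of_triangles D hK huv huw hvw hxy hxz hyz hx1
  have hi23 : (T₂ ∩ T₃).card ≤ 1 := inter_card_le_one_of_triangles D hK hab hac hbc hxy hxz hyz hx2
  by_cases hT : ∀ x' y' z', D.Adj x' y' → D.Adj x' z' → D.Adj y' z' →
      (x' ∈ T₁ ∧ y' ∈ T₁) ∨ (x' ∈ T₂ ∧ y' ∈ T₂) ∨ (x' ∈ T₃ ∧ y' ∈ T₃)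
  · rcases eq_empty_or_singleton_of_card_le_one hi12 with e12 | ⟨t, e12⟩ <;>
      rcases eq_empty_or_singleton_of_card_le_one hi13 with e13 | ⟨t', e13⟩ <;>
      rcases eq_empty_or_singleton_of_card_le_one hi23 with e23 | ⟨t'', e23⟩
    · -- three vertex-disjoint triangles need nine vertices
      exfalso
      have hd12 : Disjoint T₁ T₂ := disjoint_iff_inter_eq_empty.mpr e12
      have hd : Disjoint (T₁ ∪ T₂) T₃ := disjoint_union_left.mpr
        ⟨disjoint_iff_inter_eq_empty.mpr e13, disjoint_iff_inter_eq_empty.mpr e23⟩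
      have := card_le_univ (T₁ ∪ T₂ ∪ T₃)
      rw [card_union_of_disjoint hd, card_union_of_disjoint hd12, h₁, h₂, h₃, hk] at this
      omega
    · exact three_triangles_one_shared_eight_thirteen D hK hk hm T₂ T₃ T₁ h₂ h₃ h₁ e23
        (disjoint_iff_inter_eq_empty.mpr (by rw [inter_comm]; exact e12))
        (disjoint_iff_inter_eq_empty.mpr (by rw [inter_comm]; exact e13)) hcl₂ hcl₃ hcl₁ hone₁
        (fun x' y' z' h1 h2 h3 => by
          rcases hT x' y' z' h1 h2 h3 with h | h | h
          · exact Or.inr (Or.inr h)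
          · exact Or.inl h
          · exact Or.inr (Or.inl h))
    · exact three_triangles_one_shared_eight_thirteen D hK hk hm T₁ T₃ T₂ h₁ h₃ h₂ e13
        (disjoint_iff_inter_eq_empty.mpr e12)
        (disjoint_iff_inter_eq_empty.mpr (by rw [inter_comm]; exact e23)) hcl₁ hcl₃ hcl₂ hone₂
        (fun x' y' z' h1 h2 h3 => by
          rcases hT x' y' z' h1 h2 h3 with h | h | h
          · exact Or.inl h
          · exact Or.inr (Or.inr h)
          · exact Or.inr (Or.inl h))
    · exact three_triangles_stability_two_of_path_eight D hK hk hm T₁ T₃ T₂ h₁ h₃ h₂ e13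
        (by rw [inter_comm]; exact e23) (disjoint_iff_inter_eq_empty.mpr e12) hcl₁ hcl₃ hcl₂ hone₁ hone₃ hone₂
        (fun x' y' z' h1 h2 h3 => by
          rcases hT x' y' z' h1 h2 h3 with h | h | h
          · exact Or.inl h
          · exact Or.inr (Or.inr h)
          · exact Or.inr (Or.inl h))
    · exact three_triangles_one_shared_eight_thirteen D hK hk hm T₁ T₂ T₃ h₁ h₂ h₃ e12
        (disjoint_iff_inter_eq_empty.mpr e13) (disjoint_iff_inter_eq_empty.mpr e23) hcl₁ hcl₂ hcl₃
        hone₃ hT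
    · exact three_triangles_stability_two_of_path_eight D hK hk hm T₁ T₂ T₃ h₁ h₂ h₃ e12 e23
        (disjoint_iff_inter_eq_empty.mpr e13) hcl₁ hcl₂ hcl₃ hone₁ hone₂ hone₃ hT
    · exact three_triangles_stability_two_of_path_eight D hK hk hm T₂ T₁ T₃ h₂ h₁ h₃
        (by rw [inter_comm]; exact e12) e13 (disjoint_iff_inter_eq_empty.mpr e23) hcl₂ hcl₁ hcl₃
        hone₂ hone₁ hone₃
        (fun x' y' z' h1 h2 h3 => by
          rcases hT x' y' z' h1 h2 h3 with h | h | h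
          · exact Or.inr (Or.inl h)
          · exact Or.inl h
          · exact Or.inr (Or.inr h))
    · obtain ⟨htt', htt''⟩ := shared_eq_of_three D hK h₁ hcl₁ hcl₂ hcl₃ e12 e13 e23
      subst htt'
      subst htt''
      exact three_triangles_stability_two_of_windmill D hK (by omega) hm' T₁ T₂ T₃ h₁ h₂ h₃ e12 e13 e23
        hcl₁ hcl₂ hcl₃ hone₁ hone₂ hone₃ hT
  · simp only [not_forall, not_or] at hT
    obtain ⟨x', y', z', hxy', hxz', hyz', h1, h2, h3⟩ := hT
    set T₄ : Finset V := {x', y', z'} with hT₄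
    have hx'4 : x' ∈ T₄ := by rw [hT₄]; exact mem_insert_self _ _
    have hy'4 : y' ∈ T₄ := by rw [hT₄]; exact mem_insert_of_mem (mem_insert_self _ _)
    have hne1 : T₄ ≠ T₁ := fun h => h1 ⟨h ▸ hx'4, h ▸ hy'4⟩
    have hne2 : T₄ ≠ T₂ := fun h => h2 ⟨h ▸ hx'4, h ▸ hy'4⟩
    have hne3 : T₄ ≠ T₃ := fun h => h3 ⟨h ▸ hx'4, h ▸ hy'4⟩
    have hne12 : T₁ ≠ T₂ := fun h => by rw [h, inter_self, h₂] at hi12; omega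
    have hne13 : T₁ ≠ T₃ := fun h => by rw [h, inter_self, h₃] at hi13; omega
    have hne23 : T₂ ≠ T₃ := fun h => by rw [h, inter_self, h₃] at hi23; omega
    set F : Finset (Finset V) := {T₁, T₂, T₃, T₄} with hF
    have hF4 : F.card = 4 := by
      rw [hF, card_insert_of_notMem, card_insert_of_notMem, card_insert_of_notMem, card_singleton]
      · rw [mem_singleton]; exact Ne.symm hne3
      · rw [mem_insert, mem_singleton, not_or]; exact ⟨hne23, Ne.symm hne2⟩
      · rw [mem_insert, mem_insert, mem_singleton, not_or, not_or]; exact ⟨hne12, hne13, Ne.symm hne1⟩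
    have hFtri : ∀ T ∈ F, ∃ u' v' w', D.Adj u' v' ∧ D.Adj u' w' ∧ D.Adj v' w' ∧ T = {u', v', w'} := by
      intro T hT
      rw [hF] at hT
      simp only [mem_insert, mem_singleton] at hT
      rcases hT with rfl | rfl | rfl | rfl
      · exact ⟨u, v, w, huv, huw, hvw, rfl⟩
      · exact ⟨a, b, c, hab, hac, hbc, rfl⟩
      · exact ⟨x, y, z, hxy, hxz, hyz, rfl⟩
      · exact ⟨x', y', z', hxy', hxz', hyz', rfl⟩
    by_cases hT4 : ∀ x'' y'' z'', D.Adj x'' y'' → D.Adj x'' z'' → D.Adj y'' z'' → ∃ T ∈ F, x'' ∈ T ∧ y'' ∈ T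
    · exact four_triangles_eight_thirteen D hK hk hm F hF4 hFtri hT4
    · -- a fifth triangle: `|T₃| ≥ 30` and the envelope
      simp only [not_forall, not_exists, not_and] at hT4
      obtain ⟨x'', y'', z'', hxy'', hxz'', hyz'', h5⟩ := hT4
      set T₅ : Finset V := {x'', y'', z''} with hT₅
      have hx''5 : x'' ∈ T₅ := by rw [hT₅]; exact mem_insert_self _ _
      have hy''5 : y'' ∈ T₅ := by rw [hT₅]; exact mem_insert_of_mem (mem_insert_self _ _)
      have hne5 : T₅ ∉ F := fun h => h5 T₅ h hx''5 hy''5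
      have h30 := six_mul_card_le_card_triangles3 D (insert T₅ F) (by
        intro T hT
        rw [mem_insert] at hT
        rcases hT with rfl | hT
        · exact ⟨x'', y'', z'', hxy'', hxz'', hyz'', rfl⟩
        · exact hFtri T hT)
      rw [card_insert_of_notMem hne5, hF4] at h30
      have h := stability_of_triangles D hK (by omega) 5 2 (by omega) (by rw [hk])
      have e : Fintype.card V - 2 - 1 = Fintype.card V - 3 := by omega
      rw [e] at h
      exact h

/-- **THE CELL `(8, 13)`: THE DENSE-CORNER STABILITY WITH GAP `10`.** -/
theorem dense_stability_two_eight_thirteen (D : SimpleGraph V) [DecidableRel D.Adj] (hK : K4mFree D)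
    (hk : Fintype.card V = 8) (hm : D.edgeFinset.card = 13)
    (hnot : ¬ ∃ A : Finset V, (∀ x y, D.Adj x y → (x ∈ A ↔ y ∉ A)) ∧ (missing D A Aᶜ).card ≤ 1) :
    ∑ v, deg D v * deg D v + 2 * (Fintype.card V - 3) ≤ D.edgeFinset.card * Fintype.card V := by
  have hm' : 2 * Fintype.card V ≤ D.edgeFinset.card + 3 := by omega
  by_cases hfree : D.CliqueFree 3
  · exact triangle_free_stability_two D hfree hm' hnot
  · obtain ⟨S, hS⟩ := not_forall.mp hfree
    have hS' := not_not.mp hS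
    rw [SimpleGraph.is3Clique_iff] at hS'
    obtain ⟨u, v, w, huv, huw, hvw, -⟩ := hS'
    by_cases hT : ∀ a b c, D.Adj a b → D.Adj a c → D.Adj b c → a = u ∨ a = v ∨ a = w
    · by_cases hout : ∃ z, z ∉ ({u, v, w} : Finset V) ∧ degIn D {u, v, w} z = 0
      · exact one_triangle_stability_two_of_outer D hK huv huw hvw hT hm' hout
      · apply one_triangle_eight_thirteen_no_outer D hK hk hm huv huw hvw hT
        intro z hz
        by_contra h0
        exact hout ⟨z, hz, by omega⟩
    · simp only [not_forall, not_or] at hT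
      obtain ⟨a, b, c, hab, hac, hbc, hau, hav, haw⟩ := hT
      have ha : ¬ (a = u ∨ a = v ∨ a = w) := fun h => by
        rcases h with h | h | h
        · exact hau h
        · exact hav h
        · exact haw h
      by_cases hT3 : ∀ x y z, D.Adj x y → D.Adj x z → D.Adj y z →
          x = u ∨ x = v ∨ x = w ∨ x = a ∨ x = b ∨ x = c
      · exact two_triangles_stability_two_of_eight D hK (by omega) hm' huv huw hvw hab hac hbc ha hT3
      · simp only [not_forall, not_or] at hT3
        obtain ⟨x, y, z, hxy, hxz, hyz, hxu, hxv, hxw, hxa, hxb, hxc⟩ := hT3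
        exact three_triangles_stability_two_eight_thirteen D hK hk hm huv huw hvw hab hac hbc hxy hxz hyz ha
          (fun h => by
            rcases h with h | h | h | h | h | h
            · exact hxu h
            · exact hxv h
            · exact hxw h
            · exact hxa h
            · exact hxb h
            · exact hxc h)

/-- The cell `(8, 13)` on `K₄⁻`-free graphs: `2·cherries ≤ 68`, attained (by `K_{3,5}` minus two edges at a vertex). -/
theorem cell_eight_thirteen_k4m :
    (∀ (D : SimpleGraph (Fin 8)) [DecidableRel D.Adj], K4mFree D → D.edgeFinset.card = 13 →
      2 * cherries D ≤ 68) ∧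
    ∃ (D : SimpleGraph (Fin 8)) (_ : DecidableRel D.Adj), K4mFree D ∧ D.edgeFinset.card = 13 ∧
      2 * cherries D = 68 := by
  constructor
  · intro D _ hK hD
    have hcard : Fintype.card (Fin 8) = 8 := Fintype.card_fin 8
    have hnot : ¬ ∃ A : Finset (Fin 8), (∀ x y, D.Adj x y → (x ∈ A ↔ y ∉ A)) ∧ (missing D A Aᶜ).card ≤ 1 := by
      rintro ⟨A, hA, hN⟩
      have hNX := card_missing_add_card_edges D A hA
      have hXc : Aᶜ.card = 8 - A.card := by
        have := card_add_card_compl A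
        rw [hcard] at this
        omega
      have hXk : A.card ≤ 8 := by
        have := card_le_univ A
        rwa [hcard] at this
      rw [hXc, hD] at hNX
      have hprod : ∀ a', a' ≤ 8 → 13 ≠ a' * (8 - a') ∧ 14 ≠ a' * (8 - a') := by decide
      obtain ⟨h1, h2⟩ := hprod A.card hXk
      have : (missing D A Aᶜ).card = 0 ∨ (missing D A Aᶜ).card = 1 := by omega
      rcases this with h | h
      · rw [h] at hNX; exact h1 (by omega)
      · rw [h] at hNX; exact h2 (by omega)
    have h1 := dense_stability_two_eight_thirteen D hK hcard hD hnot
    have h2 := two_mul_cherries_add D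
    have h3 := sum_deg_eq D
    rw [hcard, hD] at h1
    rw [hD] at h3
    omega
  · refine ⟨bipMinusStar 8 3 2, inferInstance, k4mFree_bipMinusStar 8 3 2, ?_, ?_⟩
    · have := card_edges_bipMinusStar 8 3 2 (by norm_num) (by norm_num)
      omega
    · have h := two_mul_cherries_bipMinusStar 8 3 2 (by norm_num) (by norm_num) (by norm_num)
      norm_num at h
      omega

/-- **TWO BELOW THE DIAGONAL IS EXACT ON THE `K₄⁻`-FREE CLASS FOR EVERY `k ≥ 8`** — every cell of the dense corner. -/
theorem two_below_diagonal_exact_k4m_of_eight (k a : ℕ) (hk : 8 ≤ k) (ha : 1 ≤ a) (hak : a + 2 ≤ k)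
    (hdense : 2 * k ≤ a * (k - a) - 2 + 3)
    (hm : ∀ a', a' ≤ k → a * (k - a) - 2 ≠ a' * (k - a') ∧ a * (k - a) - 1 ≠ a' * (k - a')) :
    (∀ (D : SimpleGraph (Fin k)) [DecidableRel D.Adj], K4mFree D →
        D.edgeFinset.card = a * (k - a) - 2 →
        2 * cherries D + 2 * (k - 3) ≤ (a * (k - a) - 2) * (k - 2)) ∧
      ∃ (D : SimpleGraph (Fin k)) (_ : DecidableRel D.Adj), K4mFree D ∧
        D.edgeFinset.card = a * (k - a) - 2 ∧ 2 * cherries D + 2 * (k - 3) = (a * (k - a) - 2) * (k - 2) := by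
  rcases Nat.lt_or_ge k 9 with hk8 | hk9
  · have hk' : k = 8 := by omega
    subst hk'
    have ha6 : a ≤ 6 := by omega
    interval_cases a
    · norm_num at hdense
    · norm_num at hdense
    · have h := cell_eight_thirteen_k4m
      norm_num
      obtain ⟨h1, D, inst, h2, h3, h4⟩ := h
      exact ⟨fun D _ hK hD => by have := h1 D hK hD; omega, D, inst, h2, h3, by omega⟩
    · exact absurd (by norm_num) (hm 3 (by norm_num)).2
    · have h := cell_eight_thirteen_k4m
      norm_num
      obtain ⟨h1, D, inst, h2, h3, h4⟩ := h
      exact ⟨fun D _ hK hD => by have := h1 D hK hD; omega, D, inst, h2, h3, by omega⟩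
    · norm_num at hdense
  · exact two_below_diagonal_exact_k4m_of_nine k a hk9 ha hak hdense hm

end C047

end TriangleCap

end PercRepro
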